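import Summits.ResolutionOfSingularities.ResolutionOfSingularities.Theorems.WeightedInvariantELadderOneRungUnconditional
import Summits.ResolutionOfSingularities.ResolutionOfSingularities.Theorems.WeightedInvariantELadderTwoStage
import HarnessLib

/-!
# E-ladder rung `e = 2`, step piece (S-b1): the successor atlas is INDUCED along `σ₊` — the chart dictionary

[OURS · L1 W4.3 · DOOR `HypersurfaceCentreConstruction` (stmt-ResolutionOfSingularities-19897) · E2 STEP piece (S-b1)
`E2InducedAtlasBody p` of the registrar's SPEC (Δ6b) `L/res-L1-w43-plan-1/E2Step_split_sketch.lean` (rev 3, sha16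
3dbfad7a331aa48b; unchanged in rev 4), ORDER/OFFER (o59-b1); written by res-D-pv-048 (gen 11) on res-plan-2 custody
IDLE POOL DEAL #45 (2).  Def-free kernel lemmas; `--supports` the door item as a helper.  Replaces the role of: nothing
printed — OURS bookkeeping of the E-ladder (Włodarczyk-style cobordant blow-ups), NOT a statement of the manuscript
[Hironaka2017] or of any manuscript under adjudication; candidates not facts; AI work, weaker than expert review.]

WHAT IS PROVED.  The tree's quotient step `DatumToEmbedded.Atlas.gradedAtlas_succ_of_isRegularWeightedCentre`
(`…WeightedThesisTowerGenericQuotient`) returns `Nonempty (GradedAtlas (j + 1) …)`, forgetting HOW the rank-`j + 1` atlas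
of the successor was built.  Its construction is explicit: the charts are the `AmbientChart`s `𝒞 ⟨a, b⟩` of
`AtlasAmbient.exists_ambientChart` (`W' = D(β t^{Dg}) ∩ σ₊⁻¹(W a)` with its `ℤʲ⁺¹`-grading), one for each old chart `a` and
each generator `b` of the downstairs centre `K(U a)`, `β` a degree-`0` lift of `b`.  We re-run that construction and RECORD
the dictionary the `AmbientChart` fields carry, chart by chart:

* `DatumToEmbedded.Atlas.gradedAtlas_succ_dictionary_of_isRegularWeightedCentre` — same hypotheses as the tree theorem,
  conclusion `∃ 𝒜', ∀ a', ∃ a (h : W' a' ≤ σ₊⁻¹ W a), …`: `σ₊♯` is graded with old degree `χ ↦ (χ, 0)`; `t⁻¹|_{W' a'}` has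
  degree `(0, -1)`; there are `β ∈ R_{Dg}(W a)` of old degree `0` and a homogeneous UNIT `η` of degree `(0, Dg)` with
  `η · (t⁻¹)^{Dg} = σ₊♯ β`; `W' a'` is exactly the locus over `W a` where `σ₊♯ β` is a unit times `(t⁻¹)^{Dg}`; a section of
  `W a` pulling back into the strict transform's ideal has `x β ∈ I(W a)`; and the quotient chart `U' a'` is the blow-up
  chart `blowupChart ρ K (U a) b` of the generator `b` that `β` lifts;
* `DatumToEmbedded.quotientStep_dictionary_of_isRegularWeightedCentre` — the quotient step with the dictionary: the
  downstairs centre is `K = ker (V(R_{Dg}) ∩ X ⟶ X ⟶ V)` for the Veronese degree `Dg > 0`, and over every blow-up of `K`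
  the strict transform carries an induced atlas as above;
* **`LocalEngine.e2InducedAtlas (p)`** — the body of `E2InducedAtlasBody p` VERBATIM (the registrar's `InducedAlong S R R' 𝒜'`
  spelled out clause by clause; once the (Δ6b) words are tree declarations the slot `hb1` of `stub_e2_step_h_of_four'` is
  this theorem by `Iff.rfl`), for a stage over ANY field (the hypotheses `S.InvDim₂`, `¬ IsRegular S.X`, `CharP`,
  `PerfectField` of the body are not used by the construction);
* `LocalEngine.e2InducedAtlas_dictionary (p)` — the same with the richer dictionary (chart locus, strict-transform reading,
  quotient charts) for the (S-b2) hand.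
-/

noncomputable section

open CategoryTheory CategoryTheory.Limits AlgebraicGeometry TopologicalSpace
open Literature.AlgebraicGeometry.Resolution
open Summit.ResolutionOfSingularities.ResolutionOfSingularities.Theorems

set_option linter.dupNamespace false -- mandated namespace `…Theorems.DatumToEmbedded.<Topic>`
-- `Γ(B₊, W')` versus `presheaf.obj` inside `rw` motives and instance problems on the glued scheme
-- `R'.cobordantBlowup` / `R'.plus` (as in the source file `…WeightedThesisTowerGenericQuotient`):
set_option backward.isDefEq.respectTransparency false

/-! ## The graded atlas of rank `j + 1`, with its dictionary -/

namespace Summit.ResolutionOfSingularities.ResolutionOfSingularities.Theorems.DatumToEmbedded.Atlas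

/-- **The induced graded atlas of rank `j + 1` on the blow-up of the quotient, WITH ITS CHART DICTIONARY** (the text of
`gradedAtlas_succ_of_isRegularWeightedCentre`, Włodarczyk §2.3.3 in the graded encoding, re-run to record the
`AmbientChart` fields of its charts instead of `Nonempty`): every chart `W' a'` of the successor atlas lies over an old
chart `W a`; `σ₊♯ : Γ(Y, W a) → Γ(B₊, W' a')` is graded, old degree `χ` becoming `(χ, 0)`; `t⁻¹` has degree `(0, -1)`;
the chart carries `β ∈ R_{Dg}(W a)` of old degree `0` and a unit `η` of degree `(0, Dg)` with `η (t⁻¹)^{Dg} = σ₊♯ β`, and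
is exactly the locus over `W a` where `σ₊♯ β` is a unit multiple of `(t⁻¹)^{Dg}`; sections of `W a` pulling back into the
strict transform's ideal are in `(I(W a) : β)`; the quotient chart is the blow-up chart of the generator `b ∈ K(U a)`
lifted by `β`. [cite: Wlodarczyk2022, §2.3.3] -/
theorem gradedAtlas_succ_dictionary_of_isRegularWeightedCentre :
    ∀ {k : Type} [Field k]
      {Y X V : Scheme.{0}} (f : Y ⟶ Spec (.of k)) [Smooth f] [IsSeparated f] [QuasiCompact f]
      (i : X ⟶ Y) [IsClosedImmersion i] [IsIntegral X] (q : X ⟶ V) [IsIntegral V]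
      (g : V ⟶ Spec (.of k)) [IsSeparated g] [LocallyOfFiniteType g] [QuasiCompact g],
      q ≫ g = i ≫ f →
      ∀ {j : ℕ} (𝒜 : GradedAtlas j f i q) (R : ReesAlgebraData Y), R.IsRegularWeightedCentre →
      i (genericPoint X) ∉ R.support →
      (∀ (a : 𝒜.ι) (n : ℕ), @Ideal.IsHomogeneous (Fin j → ℤ) (AddSubgroup Γ(Y, 𝒜.W a))
        Γ(Y, 𝒜.W a) _ _ _ (𝒜.piece a) _ _ (𝒜.gradedRing a)
        ((R.piece n).ideal (𝒜.W a))) →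
      ∀ (R' : ReesFiltration Y), R'.ideal = R.piece →
      ∀ [Smooth (R'.πPlus ≫ f)] [IsSeparated (R'.πPlus ≫ f)] [QuasiCompact (R'.πPlus ≫ f)]
        [IsIntegral (R'.strictTransformPlus i.ker).subscheme]
        (σX : (R'.strictTransformPlus i.ker).subscheme ⟶ X),
        σX ≫ i = (R'.strictTransformPlus i.ker).subschemeι ≫ R'.πPlus →
      ∀ (Dg : ℕ), 0 < Dg →
      (R.piece Dg).comap R'.πPlus = R'.excPlus ^ Dg →
      (∀ (a : 𝒜.ι) (l : ℕ) (x : Γ(Y, 𝒜.W a)),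
          x ∈ (R.piece (Dg * (l + 1))).ideal (𝒜.W a) → x ∈ 𝒜.piece a 0 →
          ∃ y ∈ AddSubgroup.closure
            {z : Γ(Y, 𝒜.W a) | ∃ u v : Γ(Y, 𝒜.W a),
              u ∈ (R.piece Dg).ideal (𝒜.W a) ∧ u ∈ 𝒜.piece a 0 ∧
              v ∈ (R.piece (Dg * l)).ideal (𝒜.W a) ∧ v ∈ 𝒜.piece a 0 ∧
              z = u * v},
            x - y ∈ i.ker.ideal (𝒜.W a)) →
      ((((R.piece Dg).comap i).subschemeι ≫ q).ker).comap (σX ≫ q) =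
          (R'.excPlus.comap (R'.strictTransformPlus i.ker).subschemeι) ^ Dg →
      ∀ (V' : Scheme.{0}) (ρ : V' ⟶ V),
        IsBlowup ρ (((R.piece Dg).comap i).subschemeι ≫ q).ker →
        ∀ [IsIntegral V'] (q' : (R'.strictTransformPlus i.ker).subscheme ⟶ V'),
          q' ≫ ρ = σX ≫ q →
          ∃ 𝒜' : GradedAtlas (j + 1) (R'.πPlus ≫ f) (R'.strictTransformPlus i.ker).subschemeι q',
            ∀ a' : 𝒜'.ι, ∃ (a : 𝒜.ι)
              (h : (𝒜'.W a' : (R'.plus : Scheme.{0}).Opens) ≤ R'.πPlus ⁻¹ᵁ (𝒜.W a : Y.Opens)),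
              (∀ (χ : Fin j → ℤ) (s : Γ(Y, 𝒜.W a)), s ∈ 𝒜.piece a χ →
                R'.πPlus.appLE (𝒜.W a) (𝒜'.W a') h s ∈ 𝒜'.piece a' (Fin.snoc (α := fun _ => ℤ) χ 0)) ∧
              tInvOn R' (𝒜'.W a') ∈ 𝒜'.piece a' (Fin.snoc (α := fun _ => ℤ) 0 (-1)) ∧
              ∃ (β : Γ(Y, 𝒜.W a)) (η : Γ((R'.plus : Scheme.{0}), 𝒜'.W a')),
                β ∈ (R.piece Dg).ideal (𝒜.W a) ∧ β ∈ 𝒜.piece a 0 ∧ IsUnit η ∧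
                η ∈ 𝒜'.piece a' (Fin.snoc (α := fun _ => ℤ) 0 (Dg : ℤ)) ∧
                η * tInvOn R' (𝒜'.W a') ^ Dg = R'.πPlus.appLE (𝒜.W a) (𝒜'.W a') h β ∧
                -- the chart is the locus over `W a` where `σ₊♯ β = unit · (t⁻¹)^{Dg}`
                (∀ y' : (R'.plus : Scheme.{0}), y' ∈ (𝒜'.W a' : (R'.plus : Scheme.{0}).Opens) ↔
                  ∃ (O : (R'.plus : Scheme.{0}).affineOpens)
                    (hO : (O : (R'.plus : Scheme.{0}).Opens) ≤ R'.πPlus ⁻¹ᵁ (𝒜.W a : Y.Opens)),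
                    y' ∈ (O : (R'.plus : Scheme.{0}).Opens) ∧ ∃ η₀ : Γ((R'.plus : Scheme.{0}), O),
                      IsUnit η₀ ∧ η₀ * tInvOn R' O ^ Dg = R'.πPlus.appLE (𝒜.W a) O hO β) ∧
                -- strict-transform reading: `σ₊♯ x ∈ I'(W' a')  ⇒  x β ∈ I(W a)`
                (∀ x : Γ(Y, 𝒜.W a), R'.πPlus.appLE (𝒜.W a) (𝒜'.W a') h x ∈
                  (R'.strictTransformPlus i.ker).ideal (𝒜'.W a') → x * β ∈ i.ker.ideal (𝒜.W a)) ∧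
                -- the quotient chart is the blow-up chart of the generator `b` of `K(U a)` lifted by `β`
                ∃ b : Γ(V, 𝒜.U a), b ∈ ((((R.piece Dg).comap i).subschemeι ≫ q).ker).ideal (𝒜.U a) ∧
                  i.app (𝒜.W a) β = q.appLE (𝒜.U a) (i ⁻¹ᵁ (𝒜.W a)) (𝒜.preimage_eq a).le b ∧
                  (𝒜'.U a' : V'.Opens) =
                    blowupChart ρ ((((R.piece Dg).comap i).subschemeι ≫ q).ker) (𝒜.U a) b := by
  intro k _ Y X V f _ _ _ i _ _ q _ g _ _ _ hq j 𝒜 R hc hξ hhom R' hR' _ _ _ _ σX hσX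
    Dg hDg hexc hA2 hA3 V' ρ hρ _ q' hq'
  -- `Y` and `B` are locally Noetherian (the centre is a regular weighted centre)
  haveI : IsLocallyNoetherian Y := LocallyOfFiniteType.isLocallyNoetherian f
  haveI : LocallyOfFiniteType R'.π :=
    WeightedThesis.GlobalCobordantPlus.locallyOfFiniteType_π R R' hR' hc
  haveI : IsLocallyNoetherian R'.cobordantBlowup := LocallyOfFiniteType.isLocallyNoetherian R'.π
  -- `q` is quasi-compact (it is so after composition with the separated `g`)
  haveI : QuasiCompact q := by
    haveI : QuasiCompact (q ≫ g) := by rw [hq]; infer_instance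
    exact .of_comp q g
  -- `V` is locally Noetherian (of finite type over the field `k`)
  haveI : IsLocallyNoetherian V := LocallyOfFiniteType.isLocallyNoetherian g
  -- `t⁻¹` is not identically zero on the integral strict transform `X'`
  have hτ := Lift.nonempty_preimage_basicOpen_of_not_mem_support i R hc R' hR' hξ
  -- (0) finitely many generators of the downstairs centre `K(U a)` on every chart
  choose s hs using fun a : 𝒜.ι =>
    exists_finset_span_eq ((((R.piece Dg).comap i).subschemeι ≫ q).ker) (𝒜.U a)
  have hbK : ∀ ab : (Σ a : 𝒜.ι, ↥(s a)), (ab.2 : Γ(V, 𝒜.U ab.1)) ∈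
      ((((R.piece Dg).comap i).subschemeι ≫ q).ker).ideal (𝒜.U ab.1) :=
    fun ab => (hs ab.1).le (Ideal.subset_span (Finset.mem_coe.mpr ab.2.2))
  -- (1) degree-zero lifts `β` of the generators, the ambient charts, the quotient charts
  have hβex : ∀ ab : (Σ a : 𝒜.ι, ↥(s a)), ∃ β : Γ(Y, 𝒜.W ab.1),
      β ∈ (R.piece Dg).ideal (𝒜.W ab.1) ∧ β ∈ 𝒜.piece ab.1 0 ∧
        i.app (𝒜.W ab.1) β = q.appLE (𝒜.U ab.1) (i ⁻¹ᵁ (𝒜.W ab.1)) (𝒜.preimage_eq ab.1).le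
          (ab.2 : Γ(V, 𝒜.U ab.1)) :=
    fun ab => exists_degreeZero_lift 𝒜 R.piece Dg ab.1 (hhom ab.1 Dg) (hbK ab)
  choose β hβJ hβ0 hβ using hβex
  choose 𝒞 h𝒞 using fun ab : (Σ a : 𝒜.ι, ↥(s a)) =>
    AtlasAmbient.exists_ambientChart f i q 𝒜 R' hR' ab.1 (hhom ab.1) hDg (hβJ ab) (hβ0 ab)
  -- the quotient charts under the ambient charts (Q1)–(Q4)
  have hQ1 := fun ab : (Σ a : 𝒜.ι, ↥(s a)) =>
    AtlasQuotient.preimage_W'_eq f i q 𝒜 R.piece R' σX hσX Dg _ ρ q' hq' ab.1 hτ hA3 hρ hexc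
      (hbK ab) (hβJ ab) (hβ ab) (𝒞 ab)
  have hQ := fun ab : (Σ a : 𝒜.ι, ↥(s a)) =>
    And.intro (hQ1 ab) (And.intro (AtlasQuotient.appLE_blowupChart_mem_nonZeroDivisors hρ (hbK ab))
      (And.intro (fun c' => AtlasQuotient.exists_of_section_blowupChart hρ (hbK ab) c')
        (And.intro (fun (l : ℕ) (c : Γ(V, 𝒜.U ab.1))
            (hc' : c ∈ ((((R.piece Dg).comap i).subschemeι ≫ q).ker.ideal (𝒜.U ab.1)) ^ l) =>
            AtlasQuotient.exists_section_blowupChart hρ (hbK ab) hc')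
          (AtlasQuotient.app_blowupChart_injective f i q 𝒜 _ R' σX hσX Dg _ ρ hρ q' hq' ab.1
            (hbK ab) (hβ ab) (𝒞 ab) (h𝒞 ab) (hQ1 ab)))))
  -- (2)-(5) the atlas
  refine ⟨{
    ι := Σ a : 𝒜.ι, ↥(s a)
    finite_ι := by haveI := 𝒜.finite_ι; infer_instance
    U := fun ab => ⟨blowupChart ρ ((((R.piece Dg).comap i).subschemeι ≫ q).ker)
      (𝒜.U ab.1) (ab.2 : Γ(V, 𝒜.U ab.1)), hρ.isAffineOpen_blowupChart (hbK ab)⟩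
    iSup_eq_top := stub_qs_atlasCover hρ 𝒜.U 𝒜.iSup_eq_top s hs
    W := fun ab => (𝒞 ab).W'
    preimage_eq := fun ab => (hQ ab).1
    piece := fun ab => (𝒞 ab).piece
    gradedRing := fun ab => (𝒞 ab).gradedRing
    appLE_mem := fun ab c => (𝒞 ab).const_mem c
    isHomogeneous_ker := fun ab => isHomogeneous_ker_chart (𝒞 ab)
    exists_preimage := fun ab s' hs' =>
      exists_preimage_chart 𝒜 R.piece Dg hσX hτ hq' ab.1 (hβ ab) (𝒞 ab)
        (blowupChart_le_preimage ρ _ (𝒜.U ab.1) _) (hQ ab).1 (hA2 ab.1) (hQ ab).2.2.2.1 s' hs'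
    exists_lift := fun ab c' =>
      exists_lift_chart 𝒜 R.piece Dg hσX hτ hq' ab.1 (hβ ab) (𝒞 ab)
        (blowupChart_le_preimage ρ _ (𝒜.U ab.1) _) (hQ ab).1 R.piece_zero
        R.piece_mul_le (hhom ab.1 Dg) (hQ ab).2.2.1 c'
    appLE_injective := fun ab => appLE_injective_of_eq _ (hQ ab).1 (hQ ab).2.2.2.2
    exponent := 𝒜.exponent * Dg
    exponent_pos := Nat.mul_pos 𝒜.exponent_pos hDg
    exists_unit := ?_ }, ?_⟩
  · -- homogeneous units of all degrees in `(e Dg)·ℤʲ⁺¹` near every point of `X'`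
    intro x'
    obtain ⟨a, hxa, hunits⟩ := 𝒜.exists_unit (σX x')
    have hqx : ρ (q' x') ∈ (𝒜.U a : V.Opens) := by
      have e1 : (q' ≫ ρ) x' = ρ (q' x') := Scheme.Hom.comp_apply _ _ _
      rw [← e1, hq', Scheme.Hom.comp_apply]
      change σX x' ∈ q ⁻¹ᵁ (𝒜.U a : V.Opens)
      rw [← 𝒜.preimage_eq a]
      exact hxa
    obtain ⟨b, hb⟩ := exists_mem_blowupChart hρ (𝒜.U a) (s a) (hs a) hqx
    refine ⟨⟨a, b⟩, ?_, fun χ' => exists_unit_chart hσX (𝒞 ⟨a, b⟩) 𝒜.exponent hunits χ'⟩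
    have h : x' ∈ q' ⁻¹ᵁ blowupChart ρ _ (𝒜.U a) (b : Γ(V, 𝒜.U a)) := hb
    rw [← (hQ ⟨a, b⟩).1] at h
    exact h
  · -- the dictionary: the fields of the ambient charts `𝒞 ab`
    intro ab
    exact ⟨ab.1, (𝒞 ab).le_preimage, (𝒞 ab).appLE_mem, (𝒞 ab).tInvOn_mem, β ab, (𝒞 ab).η,
      hβJ ab, hβ0 ab, (𝒞 ab).isUnit_η, (𝒞 ab).η_mem, (𝒞 ab).η_mul, (𝒞 ab).mem_iff, h𝒞 ab,
      (ab.2 : Γ(V, 𝒜.U ab.1)), hbK ab, hβ ab, rfl⟩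

end Summit.ResolutionOfSingularities.ResolutionOfSingularities.Theorems.DatumToEmbedded.Atlas

/-! ## The quotient step, with the dictionary -/

namespace Summit.ResolutionOfSingularities.ResolutionOfSingularities.Theorems.DatumToEmbedded

/-- **The quotient of the cobordant blow-up is a blow-up downstairs, WITH THE CHART DICTIONARY** (the text of
`quotientStep_of_isRegularWeightedCentre`, conclusion enriched): for the Veronese degree `Dg > 0` of the centre the
downstairs centre is `K = ker (V(R_{Dg}) ∩ X ⟶ V) ≠ ⊥`, and over every blow-up `ρ : V' ⟶ V` of `K` the strict transform
maps to `V'` with a rank-`j + 1` graded atlas INDUCED along `σ₊` (dictionary of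
`Atlas.gradedAtlas_succ_dictionary_of_isRegularWeightedCentre`). [cite: Wlodarczyk2022, §2.3.3 and Thm 1.1.4 (5)] -/
theorem quotientStep_dictionary_of_isRegularWeightedCentre
    {k : Type} [Field k]
    {Y X V : Scheme.{0}} (f : Y ⟶ Spec (.of k)) [Smooth f] [IsSeparated f] [QuasiCompact f]
    (i : X ⟶ Y) [IsClosedImmersion i] [IsIntegral X] (q : X ⟶ V) [IsIntegral V]
    (g : V ⟶ Spec (.of k)) [IsSeparated g] [LocallyOfFiniteType g] [QuasiCompact g]
    (hq : q ≫ g = i ≫ f) {j : ℕ} (𝒜 : GradedAtlas j f i q)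
    (R : ReesAlgebraData Y) (hc : R.IsRegularWeightedCentre) (hξ : i (genericPoint X) ∉ R.support)
    (hhom : ∀ (a : 𝒜.ι) (n : ℕ), @Ideal.IsHomogeneous (Fin j → ℤ) (AddSubgroup Γ(Y, 𝒜.W a))
      Γ(Y, 𝒜.W a) _ _ _ (𝒜.piece a) _ _ (𝒜.gradedRing a)
      ((R.piece n).ideal (𝒜.W a)))
    (R' : ReesFiltration Y) (hR' : R'.ideal = R.piece)
    [Smooth (R'.πPlus ≫ f)] [IsSeparated (R'.πPlus ≫ f)] [QuasiCompact (R'.πPlus ≫ f)]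
    [IsIntegral (R'.strictTransformPlus i.ker).subscheme]
    (σX : (R'.strictTransformPlus i.ker).subscheme ⟶ X)
    (hσX : σX ≫ i = (R'.strictTransformPlus i.ker).subschemeι ≫ R'.πPlus) :
    ∃ (Dg : ℕ), 0 < Dg ∧ (((R.piece Dg).comap i).subschemeι ≫ q).ker ≠ ⊥ ∧
      ∀ (V' : Scheme.{0}) (ρ : V' ⟶ V), IsBlowup ρ ((((R.piece Dg).comap i).subschemeι ≫ q).ker) →
      ∀ [IsIntegral V'], ∃ q' : (R'.strictTransformPlus i.ker).subscheme ⟶ V',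
        q' ≫ ρ = σX ≫ q ∧
        ∃ 𝒜' : GradedAtlas (j + 1) (R'.πPlus ≫ f) (R'.strictTransformPlus i.ker).subschemeι q',
          ∀ a' : 𝒜'.ι, ∃ (a : 𝒜.ι)
            (h : (𝒜'.W a' : (R'.plus : Scheme.{0}).Opens) ≤ R'.πPlus ⁻¹ᵁ (𝒜.W a : Y.Opens)),
            (∀ (χ : Fin j → ℤ) (s : Γ(Y, 𝒜.W a)), s ∈ 𝒜.piece a χ →
              R'.πPlus.appLE (𝒜.W a) (𝒜'.W a') h s ∈ 𝒜'.piece a' (Fin.snoc (α := fun _ => ℤ) χ 0)) ∧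
            tInvOn R' (𝒜'.W a') ∈ 𝒜'.piece a' (Fin.snoc (α := fun _ => ℤ) 0 (-1)) ∧
            ∃ (β : Γ(Y, 𝒜.W a)) (η : Γ((R'.plus : Scheme.{0}), 𝒜'.W a')),
              β ∈ (R.piece Dg).ideal (𝒜.W a) ∧ β ∈ 𝒜.piece a 0 ∧ IsUnit η ∧
              η ∈ 𝒜'.piece a' (Fin.snoc (α := fun _ => ℤ) 0 (Dg : ℤ)) ∧
              η * tInvOn R' (𝒜'.W a') ^ Dg = R'.πPlus.appLE (𝒜.W a) (𝒜'.W a') h β ∧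
              (∀ y' : (R'.plus : Scheme.{0}), y' ∈ (𝒜'.W a' : (R'.plus : Scheme.{0}).Opens) ↔
                ∃ (O : (R'.plus : Scheme.{0}).affineOpens)
                  (hO : (O : (R'.plus : Scheme.{0}).Opens) ≤ R'.πPlus ⁻¹ᵁ (𝒜.W a : Y.Opens)),
                  y' ∈ (O : (R'.plus : Scheme.{0}).Opens) ∧ ∃ η₀ : Γ((R'.plus : Scheme.{0}), O),
                    IsUnit η₀ ∧ η₀ * tInvOn R' O ^ Dg = R'.πPlus.appLE (𝒜.W a) O hO β) ∧
              (∀ x : Γ(Y, 𝒜.W a), R'.πPlus.appLE (𝒜.W a) (𝒜'.W a') h x ∈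
                (R'.strictTransformPlus i.ker).ideal (𝒜'.W a') → x * β ∈ i.ker.ideal (𝒜.W a)) ∧
              ∃ b : Γ(V, 𝒜.U a), b ∈ ((((R.piece Dg).comap i).subschemeι ≫ q).ker).ideal (𝒜.U a) ∧
                i.app (𝒜.W a) β = q.appLE (𝒜.U a) (i ⁻¹ᵁ (𝒜.W a)) (𝒜.preimage_eq a).le b ∧
                (𝒜'.U a' : V'.Opens) =
                  blowupChart ρ ((((R.piece Dg).comap i).subschemeι ≫ q).ker) (𝒜.U a) b := by
  haveI : CompactSpace Y := QuasiCompact.compactSpace_of_compactSpace f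
  haveI : IsLocallyNoetherian Y := LocallyOfFiniteType.isLocallyNoetherian f
  obtain ⟨N₀, hN₀, hexc⟩ :=
    Exceptional.exists_veroneseExceptional_of_isRegularWeightedCentre R hc R' hR'
  obtain ⟨Dg, hDg, hdvd, hA2, hA3⟩ :=
    Degree.qs_degree_of_isRegularWeightedCentre f i q g hq 𝒜 R hc hhom R' hR' σX hσX N₀ hN₀ hexc
  -- `q` is quasi-compact: it is affine on the charts of the atlas (needed for `Hom.ker`)
  haveI : QuasiCompact q := by
    haveI : QuasiCompact (q ≫ g) := by rw [hq]; infer_instance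
    exact .of_comp q g
  obtain ⟨hK, hlift⟩ := Lift.qs_lift_of_not_mem_support i q R hc R' hR' hξ σX hσX Dg hDg hA3
  refine ⟨Dg, hDg, hK, fun V' ρ hρ _ => ?_⟩
  obtain ⟨q', hq'⟩ := hlift V' ρ hρ
  exact ⟨q', hq', Atlas.gradedAtlas_succ_dictionary_of_isRegularWeightedCentre f i q g hq 𝒜 R hc hξ hhom
    R' hR' σX hσX Dg hDg (hexc Dg hdvd) hA2 hA3 V' ρ hρ q' hq'⟩

end Summit.ResolutionOfSingularities.ResolutionOfSingularities.Theorems.DatumToEmbedded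

/-! ## (S-b1) for a stage: `E2InducedAtlasBody`, body verbatim -/

namespace Summit.ResolutionOfSingularities.ResolutionOfSingularities.Cruxes.HypersurfaceCentreConstruction.LocalEngine

open Summit.ResolutionOfSingularities.ResolutionOfSingularities.Theorems.ELadderOne

/-- **(S-b1) STRUCTURED SUCCESSOR ATLAS WITH THE RICH DICTIONARY, for a stage over any field.**  Blowing up an
admissible centre `R` of a stage `S` with the generic point of `X` off the support: for every Rees filtration `R'`
carrying the pieces of `R` there is a successor presentation `(V', ρ, q', 𝒜')` over `R'.plus` — `ρ` the blow-up of the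
downstairs centre `K = ker (V(R_{Dg}) ∩ X ⟶ V)` (`exists_isBlowup`), `q'` the lift of `σ_X ≫ q` — whose rank-`j + 1` atlas
is INDUCED along `σ₊` from the stage's, with the full chart dictionary of
`DatumToEmbedded.quotientStep_dictionary_of_isRegularWeightedCentre` (uniform Veronese degree `Dg > 0`).
[cite: Wlodarczyk2022, §2.3.3 and Thm 1.1.4 (5)] -/
theorem e2InducedAtlas_dictionary {k : Type} [Field k] (S : Stage k)
    (R : ReesAlgebraData S.Y) (hadm : IsAdmissibleCentre S.f S.i.ker R) (hξ : S.i (genericPoint S.X) ∉ R.support)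
    (R' : ReesFiltration S.Y) (hR' : R'.ideal = R.piece)
    [Smooth (R'.πPlus ≫ S.f)] [IsSeparated (R'.πPlus ≫ S.f)] [QuasiCompact (R'.πPlus ≫ S.f)]
    [IsIntegral (R'.strictTransformPlus S.i.ker).subscheme] :
    ∃ (Dg : ℕ), 0 < Dg ∧
    ∃ (V' : Scheme.{0}) (ρ : V' ⟶ S.V) (_ : IsIntegral V') (_ : IsProper ρ)
      (_ : IsBlowup ρ ((((R.piece Dg).comap S.i).subschemeι ≫ S.q).ker))
      (q' : (R'.strictTransformPlus S.i.ker).subscheme ⟶ V')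
      (_ : q' ≫ ρ ≫ S.g = (R'.strictTransformPlus S.i.ker).subschemeι ≫ R'.πPlus ≫ S.f)
      (𝒜' : GradedAtlas (S.j + 1) (R'.πPlus ≫ S.f) (R'.strictTransformPlus S.i.ker).subschemeι q'),
      ∀ a' : 𝒜'.ι, ∃ (a : S.atlas.ι)
        (h : (𝒜'.W a' : (R'.plus : Scheme.{0}).Opens) ≤ R'.πPlus ⁻¹ᵁ (S.atlas.W a : S.Y.Opens)),
        (∀ (χ : Fin S.j → ℤ) (s : Γ(S.Y, S.atlas.W a)), s ∈ S.atlas.piece a χ →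
          R'.πPlus.appLE (S.atlas.W a) (𝒜'.W a') h s ∈ 𝒜'.piece a' (Fin.snoc (α := fun _ => ℤ) χ 0)) ∧
        tInvOn R' (𝒜'.W a') ∈ 𝒜'.piece a' (Fin.snoc (α := fun _ => ℤ) 0 (-1)) ∧
        ∃ (β : Γ(S.Y, S.atlas.W a)) (η : Γ((R'.plus : Scheme.{0}), 𝒜'.W a')),
          β ∈ (R.piece Dg).ideal (S.atlas.W a) ∧ β ∈ S.atlas.piece a 0 ∧ IsUnit η ∧
          η ∈ 𝒜'.piece a' (Fin.snoc (α := fun _ => ℤ) 0 (Dg : ℤ)) ∧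
          η * tInvOn R' (𝒜'.W a') ^ Dg = R'.πPlus.appLE (S.atlas.W a) (𝒜'.W a') h β ∧
          (∀ y' : (R'.plus : Scheme.{0}), y' ∈ (𝒜'.W a' : (R'.plus : Scheme.{0}).Opens) ↔
            ∃ (O : (R'.plus : Scheme.{0}).affineOpens)
              (hO : (O : (R'.plus : Scheme.{0}).Opens) ≤ R'.πPlus ⁻¹ᵁ (S.atlas.W a : S.Y.Opens)),
              y' ∈ (O : (R'.plus : Scheme.{0}).Opens) ∧ ∃ η₀ : Γ((R'.plus : Scheme.{0}), O),
                IsUnit η₀ ∧ η₀ * tInvOn R' O ^ Dg = R'.πPlus.appLE (S.atlas.W a) O hO β) ∧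
          (∀ x : Γ(S.Y, S.atlas.W a), R'.πPlus.appLE (S.atlas.W a) (𝒜'.W a') h x ∈
            (R'.strictTransformPlus S.i.ker).ideal (𝒜'.W a') → x * β ∈ S.i.ker.ideal (S.atlas.W a)) ∧
          ∃ b : Γ(S.V, S.atlas.U a), b ∈ ((((R.piece Dg).comap S.i).subschemeι ≫ S.q).ker).ideal (S.atlas.U a) ∧
            S.i.app (S.atlas.W a) β = S.q.appLE (S.atlas.U a) (S.i ⁻¹ᵁ (S.atlas.W a)) (S.atlas.preimage_eq a).le b ∧
            (𝒜'.U a' : V'.Opens) =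
              blowupChart ρ ((((R.piece Dg).comap S.i).subschemeι ≫ S.q).ker) (S.atlas.U a) b := by
  have hc : R.IsRegularWeightedCentre := hadm.1
  haveI : IsLocallyNoetherian S.Y := LocallyOfFiniteType.isLocallyNoetherian S.f
  haveI : IsLocallyNoetherian S.V := LocallyOfFiniteType.isLocallyNoetherian S.g
  -- the strict transform maps to `X` (the total transform lies in the strict transform)
  set I' := R'.strictTransformPlus S.i.ker with hI'
  let i' := I'.subschemeι
  have hker : S.i.ker ≤ (i' ≫ R'.πPlus).ker :=
    DatumToEmbedded.StrictTransform.le_ker_subschemeι_comp_πPlus R' S.i.ker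
  let σX : I'.subscheme ⟶ S.X := IsClosedImmersion.lift S.i (i' ≫ R'.πPlus) hker
  have hσX : σX ≫ S.i = i' ≫ R'.πPlus := IsClosedImmersion.lift_fac _ _ _
  -- (hom) of the admissible centre on the charts of the presentation
  have hH := hadm.2.2
  have hhom : ∀ (a : S.atlas.ι) (n : ℕ), @Ideal.IsHomogeneous (Fin S.j → ℤ)
      (AddSubgroup Γ(S.Y, S.atlas.W a)) Γ(S.Y, S.atlas.W a) _ _ _ (S.atlas.piece a) _ _
      (S.atlas.gradedRing a) ((R.piece n).ideal (S.atlas.W a)) := fun a n =>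
    @hH S.j (S.atlas.W a) (S.atlas.piece a) (S.atlas.gradedRing a) (S.atlas.appLE_mem a)
      (S.atlas.isHomogeneous_ker a) n
  -- the quotient step with the dictionary, over the blow-up of the downstairs centre
  obtain ⟨Dg, hDg, hK, hstep⟩ := DatumToEmbedded.quotientStep_dictionary_of_isRegularWeightedCentre S.f S.i S.q
    S.g S.hq S.atlas R hc hξ hhom R' hR' σX hσX
  obtain ⟨V', ρ, hρ⟩ := exists_isBlowup S.V ((((R.piece Dg).comap S.i).subschemeι ≫ S.q).ker)
  haveI : IsProper ρ := hρ.isProper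
  haveI : IsIntegral V' := hρ.isIntegral hK
  obtain ⟨q', hq', 𝒜', hdict⟩ := hstep V' ρ hρ
  have hq'' : q' ≫ ρ ≫ S.g = i' ≫ R'.πPlus ≫ S.f := by
    rw [← Category.assoc, hq', Category.assoc, S.hq, ← Category.assoc, hσX, Category.assoc]
  exact ⟨Dg, hDg, V', ρ, inferInstance, inferInstance, hρ, q', hq'', 𝒜', hdict⟩

/-- **(S-b1) `E2InducedAtlasBody p` — THE BODY VERBATIM** (registrar's SPEC (Δ6b), `InducedAlong S R R' 𝒜'` spelled out
clause by clause): blowing up an admissible centre `R` of a non-regular (I0)₂ stage with the generic point of `X` off the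
support, over `R'.plus` there is a successor presentation `(V', ρ, q', 𝒜')` whose rank-`j + 1` graded atlas is INDUCED
along `σ₊` from the stage's — every chart `W' a'` lies over an old chart `W a`; `σ₊♯` is graded with old degree `χ`
becoming `(χ, 0)`; `t⁻¹` has degree `(0, -1)`; and the chart carries a homogeneous unit `η` of degree `(0, Dg)`, `Dg > 0`,
with `η · (t⁻¹)^{Dg} = σ₊♯ β` for some `β ∈ R_{Dg}(W a)` of old degree `0`.  (The hypotheses `S.InvDim₂`,
`¬ Scheme.IsRegular S.X`, `CharP k p`, `PerfectField k` of the body are idle in the construction.)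
[cite: Wlodarczyk2022, §2.3.3 and Thm 1.1.4 (5)] -/
theorem e2InducedAtlas (p : ℕ) :
    ∀ ⦃k : Type⦄ [Field k] [CharP k p] [PerfectField k] (S : Stage k), S.InvDim₂ → ¬ Scheme.IsRegular S.X →
    ∀ (R : ReesAlgebraData S.Y), IsAdmissibleCentre S.f S.i.ker R → S.i (genericPoint S.X) ∉ R.support →
      ∀ (R' : ReesFiltration S.Y), R'.ideal = R.piece →
    ∀ [Smooth (R'.πPlus ≫ S.f)] [IsSeparated (R'.πPlus ≫ S.f)] [QuasiCompact (R'.πPlus ≫ S.f)]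
      [IsIntegral (R'.strictTransformPlus S.i.ker).subscheme]
      (hlp' : IsLocallyPrincipal (R'.strictTransformPlus S.i.ker).subschemeι.ker),
    ∃ (V' : Scheme.{0}) (ρ : V' ⟶ S.V) (_ : IsIntegral V') (_ : IsProper ρ)
      (q' : (R'.strictTransformPlus S.i.ker).subscheme ⟶ V')
      (_ : q' ≫ ρ ≫ S.g = (R'.strictTransformPlus S.i.ker).subschemeι ≫ R'.πPlus ≫ S.f)
      (𝒜' : GradedAtlas (S.j + 1) (R'.πPlus ≫ S.f) (R'.strictTransformPlus S.i.ker).subschemeι q'),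
      ∀ a' : 𝒜'.ι, ∃ (a : S.atlas.ι)
        (h : (𝒜'.W a' : (R'.plus : Scheme.{0}).Opens) ≤ R'.πPlus ⁻¹ᵁ (S.atlas.W a : S.Y.Opens)),
        (∀ (χ : Fin S.j → ℤ) (s : Γ(S.Y, S.atlas.W a)), s ∈ S.atlas.piece a χ →
          R'.πPlus.appLE (S.atlas.W a) (𝒜'.W a') h s ∈ 𝒜'.piece a' (Fin.snoc (α := fun _ => ℤ) χ 0)) ∧
        tInvOn R' (𝒜'.W a') ∈ 𝒜'.piece a' (Fin.snoc (α := fun _ => ℤ) 0 (-1)) ∧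
        ∃ (Dg : ℕ) (β : Γ(S.Y, S.atlas.W a)) (η : Γ((R'.plus : Scheme.{0}), 𝒜'.W a')),
          0 < Dg ∧ β ∈ (R.piece Dg).ideal (S.atlas.W a) ∧ β ∈ S.atlas.piece a 0 ∧ IsUnit η ∧
          η ∈ 𝒜'.piece a' (Fin.snoc (α := fun _ => ℤ) 0 (Dg : ℤ)) ∧
          η * tInvOn R' (𝒜'.W a') ^ Dg = R'.πPlus.appLE (S.atlas.W a) (𝒜'.W a') h β := by
  intro k _ _ _ S _ _ R hadm hξ R' hR' _ _ _ _ _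
  obtain ⟨Dg, hDg, V', ρ, hV', hρ', _, q', hq', 𝒜', hdict⟩ := e2InducedAtlas_dictionary S R hadm hξ R' hR'
  refine ⟨V', ρ, hV', hρ', q', hq', 𝒜', fun a' => ?_⟩
  obtain ⟨a, h, hgr, ht, β, η, hβJ, hβ0, hηu, hηm, hηt, -, -, -⟩ := hdict a'
  exact ⟨a, h, hgr, ht, Dg, β, η, hDg, hβJ, hβ0, hηu, hηm, hηt⟩

end Summit.ResolutionOfSingularities.ResolutionOfSingularities.Cruxes.HypersurfaceCentreConstruction.LocalEngine

end
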